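/-
Copyright (c) 2026 the pub-hodgecm-mathlib formalisation cell (harness21).  Dealer seat hodgecm-mathlib-LH4-plan (g10) = TIER-0 ASSEMBLER (LEAD T17-31 (R-9)),
req618 STAGE 1a «(D-RAM) FOUR-FRAME» squad (director s1808∕s1809 (3)∕s1812; LEAD directive v1.2 a4e6366df6528969 (R-7)(R-8)(K-1)(R-9)(R-10)).  TIER 0 of the
complete skeleton: the LINE `Cruxes/H413/Lines/F0_P3c_DyRamFourFrame.lean` — SIX registered stubs on the four EXPLICIT reference pieces `gselStar = (1_K, f_{T+}, f_{T−}, f_reg)`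
and the sorry-free composition to the organ `stub_DyRamCore` BY NAME.  Written BY WRITE ONLY (`ledger crux write stmt-HodgeConjecture-24833 Lines/F0_P3c_DyRamFourFrame.lean`);
no registry act (s1809 (3)).  2026-09-03.
-/
import Summits.HodgeConjecture.HodgeConjecture.Theorems.F0P3cDyRamFourFrameSocketDefs            -- ★ p854576 DEFS №2a `RankTransferWild`, `AnchorRowsWild`
import Summits.HodgeConjecture.HodgeConjecture.Theorems.F0P3cDyRamFourFramePieces                -- DEFS №3 `gselStar`, `mstarFn`, `PiecePropsWild`, `RankTableWild`, `PieceRowsWild`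
import Summits.HodgeConjecture.HodgeConjecture.Theorems.F0P3cDyRamAnchorRowsWildOfSlices        -- #15 `anchorRowsWild_of_slices` (F0P3a-p01 v1.5 §6)
import Summits.HodgeConjecture.HodgeConjecture.Theorems.F0P3cDyRamRankTransferWildOfAnchorRows  -- #6 `rankTransferWild_of_anchorRows` (GATE 1a-1 §5)
import Summits.HodgeConjecture.HodgeConjecture.Theorems.F0P3cDyRamCoreOfRankTransferWild        -- #14 `dyRamCore_of_rankTransferWild` (cert v1.1)
import Summits.HodgeConjecture.HodgeConjecture.Theorems.F0P3cDyRamPiecePropsGselStar           -- ★ «PAYER-T0-PP» (LH4-p12 g0): pays `stub_pieceProps` BY NAME ((R-15) ★-twin of the U4 export)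
import Summits.HodgeConjecture.HodgeConjecture.Theorems.F0P3cDyRamRankTableWildGselStar          -- ★ p855060 «PAYER-T0-RT» (LH4-p04 g0): pays `stub_rankTableWild` BY NAME ((R-15) ★-twin of the U4 export `rankTableWild_gselStar`)
import Summits.HodgeConjecture.HodgeConjecture.Theorems.F0P3cDyRamPieceRowsWildUnit0OfExports      -- ★ p857318 (LH4-p11 (g4); (R-24)(a)): `pieceRowsWild_gselStar_zero_of (hU3) (hDH) (hDG) : PieceRowsWild gselStar 0` — the ED. 4 pay line's head
import Summits.HodgeConjecture.HodgeConjecture.Theorems.F0P3cDyRamFourFrameLawsWildOfRecordR2      -- ★ p857343 (LH4-p05 (g4); (R-24)(b)): `fourFrameLawsWildOfRecordR2_omegaR` = the CLOSED ★ twin of U3's export (U3 ED. 15 e5c2ce7e, 0 sorries)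
import Summits.HodgeConjecture.HodgeConjecture.Theorems.F0P3cDyRamHSideAnchorRowsRUnit0OfRecord   -- ★ p858613 (LH4-p10 (g4); (R-24)(c)): `hSideAnchorRowsR_unit0_ofRecord` = the CLOSED ★ twin of U2H's export (U2H ED. 16 f0aa32f03e472ead, 0 sorries; :418 ← ★ p858565)
import Summits.HodgeConjecture.HodgeConjecture.Theorems.F0P3cDyRamAnchorCountDictionaryZero       -- ★ (unit U2G, CLOSED): `anchorCountDictionary_zero : AnchorCountDictionary 0`
import Summits.HodgeConjecture.HodgeConjecture.Theorems.F0P3cDyRamTierZeroRowsTwoThreeOfLevels    -- ★ p859234 (LH4-p06 (g6)) THE JUNCTIONS `pieceRowsWild_gselStar_two_of_fencedLaws_of_hsides`, `…three_of_fencedLaw_of_hside` (ED. 5)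
import Summits.HodgeConjecture.HodgeConjecture.Theorems.F0P3cDyRamOmegaRDefs                        -- ★ `omegaR` (the Ω schedule of record, (R-28)); brings ★ №1-R `shiftR`, ★ №1 `DyadicFence`
import Summits.HodgeConjecture.HodgeConjecture.Theorems.F0P3cDyRamStageOneBDefs                    -- ★ p859562 (F0P3a-p01 (g36)) DEFS LEAF №5 «STAGE-1b»: counts, schedules, amplitudes `amplCs`∕`amplLevHi`, law Props, H-side Props
import Summits.HodgeConjecture.HodgeConjecture.Theorems.F0P3cDyRamStageOneBDerivedDefs             -- ★ p859675 (LH4-p05 (g8)) DEFS LEAF №6 «STAGE-1b DERIVED (T₊)»: `amplShift`, `amplTransvPlusDerived`, `n0DerivedOfRecord`, (α′)(β) Props, `TransvPlusLawTarget(Derived)`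
import Summits.HodgeConjecture.HodgeConjecture.Theorems.F0P3cDyRamHSideTransvPlusGuarded       -- ★ (LH4-p14 (g6)) THE GUARDED JUNCTION `pieceRowsWild_gselStar_one_of_fencedLaw_of_rows` (form (A′): root guards `v(a−1) < v 2`, `v(b−1) < v 2` in the hA letter; p14 11:37:57Z flag, r01 BOX MT, REF5 R5-282)
import Summits.HodgeConjecture.HodgeConjecture.Theorems.F0P3cDyRamTransvPlusLawOfCleanLevels            -- ★ (LH4-p05 (g8)) THE REDUCTION BRICK `transvPlusLawTargetDerived_of` ((L-T+) derived ⟸ two clean-level laws + (α′) + (β))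
import Summits.HodgeConjecture.HodgeConjecture.Theorems.F0P3cDyRamLabelPlusCleanOfRecord               -- ★ (LH4-p13 (g8)) (α′) PAID BY NAME `dyadicFence_labelPlusCleanLawAt_derived_ofRecord` (T19-40 (R-30)(2))
import Summits.HodgeConjecture.HodgeConjecture.Theorems.F0P3cDyRamSqKappaSignLawOfBoxSum             -- ★ (LH4-p12 (g7)) (L-sq) PART 5 HEAD `dyadicFence_sqKappaSignLawAtS2_ofRecord` — pays `stub_law_sq` BY NAME (ED. 7; over ★ p860095 `SqLabelledBoxSum_holds` (LH4-p10 (g6)), ★ p860013, ★ p860059∕p860125∕p860129)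
import Summits.HodgeConjecture.HodgeConjecture.Theorems.F0P3cDyRamLevKappaSignLawsOfRecord -- ★ p860456 + ED. 2 (primed heads): the four level κ-sign laws of record (LH4-p12 (g7)); chain ★ LevLabelledBoxSum (F0P3a-p01 (g36)) ∘ ★ p860523 ∘ ★ p860250
import Summits.HodgeConjecture.HodgeConjecture.Theorems.F0P3cDyRamHSideStubsOfRecord                -- ★ p861872 (LH4-p06 (g7)) ED. 9: `levels_typeTwo_censusLaw'` = THE (LAW) END HYPOTHESIS-FREE over LH4-p07 (g9)'s RamM socket ★ p861756 `levelsCensusC`, `hEnd_ofRecord` (★ D2's section hypothesis, closed), the T₊ junction `hSideRows_transvPlus_ofRecord'`; brings ★ D2 `F0P3cDyRamHSideStubsOfLevelsCensusLaw` (p860744) transitively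
import Summits.HodgeConjecture.HodgeConjecture.Theorems.F0P3cDyRamCleanSgnOfRecord              -- ★ p862529 (β chair LH4-p05 (g9)) THE (β) PAY FILE `cleanSgn_ofRecord` (0 binders; ★ p862243 · ★ p862244 `hRest_of_heads` ⟸ ★ p862300 hK · ★ p862389 hW · ★ p862354 hB · ★ p862486 hZ) — pays `stub_law_cleanSgn` BY NAME (ED. 10)
import HarnessLib

/-!
# H413 · line `F0_P3c_DyRamFourFrame` — TIER 0 of the «(D-RAM) FOUR-FRAME» skeleton: the wild ramified dyadic socket `stub_DyRamCore` from SIX stubs on explicit pieces — ED. 5 ((R-29)(b) TYPED SPLIT BY COMPOSITION: `stub_rows_transvMinus` ∕ `stub_rows_regular` become theorem lines through the ★ p859234 junctions `pieceRowsWild_gselStar_two_of_fencedLaws_of_hsides` ∕ `pieceRowsWild_gselStar_three_of_fencedLaw_of_hside` over SIX registered STAGE-1b stubs — `stub_law_levLo ∕ stub_law_levHi ∕ stub_law_sq` (dyadic-fenced κ-sign laws at `Ω = omegaR`, letters of ★ p859562 DEFS LEAF №5) and `stub_hside_levLo ∕ stub_hside_levHi ∕ stub_hside_sq` (H-side closed-form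 triples); `stub_rows_transvPlus` stays primitive) after ED. 4 (3 of 6 tier-0 stubs PAID as theorem lines: `stub_rows_unit0` ← ★ p857318 `pieceRowsWild_gselStar_zero_of` over ★ p857343 (closed U3 twin) · ★ p858613 (closed U2H twin; :418 ← ★ p858565) · ★ `anchorCountDictionary_zero` (U2G) — heir LEAD F0P3a-plan (g20) T19-01 (1) ∕ T19-20 (α), (R-24)(a)(b)(c) ★, desk (F1); dealer∕pen LH4-plan (g12); `stub_pieceProps` ← ★ p854876, `stub_rankTableWild` ← ★ p855060, both (R-15) ★ twins of the CLOSED unit U4; signatures byte-identical to ED. 1 b2df461498609bc0; OPEN: the three `stub_rows_transvPlus ∕ transvMinus ∕ regular` = STAGE-1b debt (desk (F2)), never distance-to-h413)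

Crux H413 = `stmt-HodgeConjecture-24833` (`localTransferIdentity_holds`, R90 Prop. 4.9.1 (a) ∕ LS₂ Thm. p. 484 — verdict of record PRINT∕XL, unchanged by this file);
route `HCCMUnconditional`; cell `pub/hodgecm-mathlib`.  TARGET = the organ `stub_DyRamCore` of the sibling line `Cruxes/H413/Lines/F0_P3c_DyadicPaydown.lean` ED. 4
0265c8a902d133c3 :147–:170 (type digit 4239658620): germ-form local transfer near `1` at a WILD RAMIFIED non-split CM place for the canonical orbital families, from the
Shalika germ expansion — concluded here BY NAME as `DyRamCore_of`.

THESIS OF THE LINE (LEAD T17-27∕29∕31; memo F0P3a-p01 (g29) EVIDENCE-DRAM-WILD-CENSUS-EXT v1.2; GATE 1a-1 law socket of record v1.4 1da5af75e5e85362): at a wild place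
the unramified (D-UNR) pattern ★ `localTransferAtOne_of_germExpansion` + ★ `exists_forall_classOrbitalIntegral_eq_sum_mul_of_det_ne_zero` still closes the organ once
ONE has, for every admissible unipotent class set `S`, |S| EXPLICIT reference pieces with invertible unipotent orbital-integral table EACH OF WHICH TRANSFERS near `1`
(`RankTransferWild M`, cert v1.1).  The pieces are EXPLICIT (LEAD (R-7); REF5 R5-3 (B)): `1_K` (type-0 anchor), the two labeled near-transvection pieces `f_{T+}`, `f_{T−}`
(depth `ℓ₀ = d % 2`, p01 (B3) value-set label) and the regular profile `f_reg` at the level of record `m* = mstarFn` (DEFS LEAF №3 v3 `gselStar`) — the unipotent table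
`(1, T₊, T₋, reg) × (1_K, f_{T+}, f_{T−}, f_reg)` is LOWER TRIANGULAR with positive diagonal at every `d`, so the rank layer needs no census digit (the (K-1) edge piece
`g_E` is NOT a selector: at `d` odd its column is proportional to `1_K`'s, REF5 R5-3 (A)); each piece transfers by its THREE POPULATION ROWS (type (1) ∕ type (2) ∕ Levi —
★ `localTransferAtOne_of_populations`), which the tier-1 units pay from the FOUR-FRAME CENSUS LAWS (U3), the census dictionary (U2G), the H-side rows (U2H), the frames
(U1) and the wild lattice tree (U0).

TIER-0 STUBS (registered by this write; each ≥ M; none the crux reworded — each is one column∕layer of the germ-transfer table; (R-10) (c) explicit pieces, no shared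
`∃`-witness; (e) sorries ONLY here):
* `stub_rows_unit0       : PieceRowsWild gselStar 0` — the three population rows of `1_K` (row (1) law-fed: GATE §4 `anchorRows_of_fourFrameLaws` ★ #11-to-be; rows (2)(3) debt) [U4 ← U3, U2G, U2H]
* `stub_rows_transvPlus  : PieceRowsWild gselStar 1` — the rows of `f_{T+}` (census laws for the near-transvection profile = №4 «PIECE LAWS» debt) [U4 ← U3, U2G, U2H]
* `stub_rows_transvMinus : PieceRowsWild gselStar 2` — the rows of `f_{T−}` [U4 ← U3, U2G, U2H]
* `stub_rows_regular     : PieceRowsWild gselStar 3` — the rows of `f_reg` [U4 ← U3, U2G, U2H]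
* `stub_pieceProps       : PiecePropsWild mstarFn gselStar` — smooth ∕ K-supported ∕ Ad K ∕ left `K(ϖ_w^{m*})` for the four pieces (elementary; the label is a level-`m*` class function by construction) [U4]
* `stub_rankTableWild    : RankTableWild gselStar` — for every admissible `S` the own-column labelling has LOWER-TRIANGULAR table with positive diagonal (support∕label vanishing + positivity; `dOfPlace = d` via `stub_U0_dOfPlace_eq`) [U4 ← U0]
STAGE-1b STUBS (ED. 5; registered by this write; each ≥ M — one census∕volume law of one explicit level piece; none a row or the crux reworded; the two rows they feed are DERIVED sorry-free from them by the ★ junctions):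
* `stub_law_levLo   : ∀ K …, DyadicFence (LevKappaSignLawAtS2 shiftR omegaR depthOfRecord laLowOfRecord mstarOfRecord csOfRecord csOfRecord σ ϖ d t)` — (L-lev-lo) [F0P3a-p01 + LH4-p12]
* `stub_hside_levLo : HSideLevelsTripleS shiftR omegaR depthOfRecord laLowOfRecord mstarOfRecord amplSq` — (H-lev-lo) [LH4-p06; organs LH4-p07 ∕ LH4-p04 ∕ LH4-p08]
* `stub_law_levHi   : ∀ K …, DyadicFence (LevKappaSignLawAtS2 shiftR omegaR depthOfRecord laHighOfRecord mstarOfRecord klOfRecord blOfRecord σ ϖ d t)` — (L-lev-K) [F0P3a-p01]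
* `stub_hside_levHi : HSideLevelsTripleS shiftR omegaR depthOfRecord laHighOfRecord mstarOfRecord amplLevHi` — (H-lev-hi) [LH4-p06]
* `stub_law_sq      : ∀ K …, DyadicFence (SqKappaSignLawAtS2 shiftR omegaR depthOfRecord csOfRecord σ ϖ d t)` — (L-sq-K) [LH4-p12]
* `stub_hside_sq    : HSideSqTripleS shiftR omegaR depthOfRecord mstarOfRecord amplSq` — (H-sq) [LH4-p06; LH4-p10 ★ p859150]
ROWS DERIVED (ED. 5, sorry-free modulo the stubs): `stub_rows_transvMinus := pieceRowsWild_gselStar_two_of_fencedLaws_of_hsides shiftR omegaR depthOfRecord amplSq amplLevHi stub_rows_transvPlus stub_law_levLo stub_hside_levLo stub_law_levHi stub_hside_levHi`; `stub_rows_regular := pieceRowsWild_gselStar_three_of_fencedLaw_of_hside shiftR omegaR depthOfRecord amplSq stub_rows_unit0 stub_law_sq stub_hside_sq`.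
COMPOSITION (sorry-free, trio): `DyRamCore_of : ‹the six stub statements› → ‹stub_DyRamCore's statement VERBATIM›` :=
`dyRamCore_of_rankTransferWild mstarFn (rankTransferWild_of_anchorRows mstarFn (anchorRowsWild_of_slices mstarFn gselStar hP hR hRows))`.
TIER 1 (one socket module per unit, `F0_P3c_DyRamFourFrame/{U0_WildTree, U1_Frames, U2G_Census, U2H_HSide, U3_Laws, U4_Rows}.lean`, assemblers LH4-p01 ∕ B-p04 ∕ B-p08 ∕
LH4-p03 ∕ F0P3a-p01 ∕ F0P3a-p01) and TIER 2 (`Theorems/`, one theorem per file BY NAME) are written by their assemblers; this file imports none of them.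

FROZEN BYTES ((R-10)(f)): organ (leaf ED. 4), ★ statements, sheet v2 c03c627160493264, cert v1.1 94d1d696bbaaed50, law socket v1.4 1da5af75e5e85362; ED. 5: ★ p859234 junction binders, ★ p859562 DEFS LEAF №5 letters, desk ISSUE 17 78931a6d7d5a4dae row (ii-Y) (price), REF5 R5-274 (T19-32 (e) sign box: signs of record = the unit's ε_i in R2 currency above the fence `n0CleanOfRecord`).
HONEST LABEL: this file closes NOTHING — SEVEN `sorry`s after ED. 5 (the row of `f_{T+}` primitive + the six typed STAGE-1b letters into which the rows of `f_{T−}`, `f_reg` are split by composition — the same debt, typed, not less of it; no row newly PAID); h413 OPEN; HC_CM is proved only modulo the 7 printed citations (2 remaining: hLiu418 = stmt-HodgeConjecture-24832,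
h413 = stmt-HodgeConjecture-24833) until rung 0 closes.

## References
* [Rogawski1990] J. D. Rogawski, *Automorphic Representations of Unitary Groups in Three Variables*, Ann. of Math. Stud. 123 (1990): Prop. 4.9.1 (a) p. 55, §4.9
  pp. 55–57, §8.1 Props. 8.1.1–8.1.2 pp. 112–114, §12.2.
* [LanglandsShelstad1987] R. P. Langlands, D. Shelstad, *On the definition of transfer factors*, Math. Ann. 278 (1987), §1–§3.
* [LanglandsShelstad1990Descent] R. P. Langlands, D. Shelstad, *Descent for transfer factors*, The Grothendieck Festschrift II (1990), §2.1.
* [Jacobowitz1962] R. Jacobowitz, *Hermitian forms over local fields*, Amer. J. Math. 84 (1962) 441–465.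
-/

noncomputable section

namespace Summit.HodgeConjecture.HodgeConjecture.Cruxes.H413.F0P3cDyRamFourFrame

open MeasureTheory Measure NumberField IsDedekindDomain Topology Filter
open Literature.NumberTheory.Automorphic Literature.NumberTheory.Automorphic.UnitaryGroup Literature.NumberTheory.Automorphic.IntegralReduction
open Literature.NumberTheory.Rogawski1990 Literature.NumberTheory.GaloisRepresentations
open Literature.MeasureTheory.Group (descConj)
open scoped Matrix MatrixGroups Classical ValuativeRel
open Summit.HodgeConjecture.HodgeConjecture.Cruxes.H413.F0P3cDyRamFourFrameSocketDefs
open Summit.HodgeConjecture.HodgeConjecture.Cruxes.H413.F0P3cDyRamFourFramePieces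
open Summit.HodgeConjecture.HodgeConjecture.Cruxes.H413.F0P3cDyRamAnchorRowsWildOfSlices
open Summit.HodgeConjecture.HodgeConjecture.Cruxes.H413.F0P3cDyRamRankTransferWildOfAnchorRows
open Summit.HodgeConjecture.HodgeConjecture.Cruxes.H413.F0P3cDyRamCoreOfRankTransferWild
open scoped WithZero
open Literature.NumberTheory.Automorphic.UnitaryThreeFourFrame
open Summit.HodgeConjecture.HodgeConjecture.Cruxes.H413.F0P3cDyRamFourFrameLawDefs
open Summit.HodgeConjecture.HodgeConjecture.Cruxes.H413.F0P3cDyRamFourFrameLawDefsR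
open Summit.HodgeConjecture.HodgeConjecture.Cruxes.H413.F0P3cDyRamFourFrameLawDefsR2
open Summit.HodgeConjecture.HodgeConjecture.Cruxes.H413.F0P3cDyRamOmegaRDefs
open Summit.HodgeConjecture.HodgeConjecture.Cruxes.H413.F0P3cDyRamTierZeroRowsTwoThreeOfLevels
open Summit.HodgeConjecture.HodgeConjecture.Cruxes.H413.F0P3cDyRamStageOneBDefs
open Summit.HodgeConjecture.HodgeConjecture.Cruxes.H413.F0P3cDyRamStageOneBDerivedDefs
open Summit.HodgeConjecture.HodgeConjecture.Cruxes.H413.F0P3cDyRamHSideTransvPlusGuarded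
open Summit.HodgeConjecture.HodgeConjecture.Cruxes.H413.F0P3cDyRamTransvPlusLawOfCleanLevels
open Literature.NumberTheory.Automorphic.UnitaryLatticeTree Literature.NumberTheory.Automorphic.HermitianLattice    -- (form A only)
open Summit.HodgeConjecture.HodgeConjecture.Cruxes.H413.F0P3cDyRamFourFrameHSideDefs    -- (form A only)
open Summit.HodgeConjecture.HodgeConjecture.Cruxes.H413.F0P3cDyRamFourFrameHSideDefsR    -- (form A only)
open Summit.HodgeConjecture.HodgeConjecture.Cruxes.H413.F0P3cDyRamFourFrameHFamilyDefs    -- (form A only)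
open Summit.HodgeConjecture.HodgeConjecture.Cruxes.H413.F0P3cDyRamFourFrameCensusDefs    -- (form A only)

/-! ## §1  the six registered tier-0 stubs -/

/-- TIER-0 STUB · the three population rows (type (1) ∕ type (2) ∕ Levi) of the type-0 anchor `1_K` near `1`, ONE H-family per (place, μ) (LEAD (R-6)); row (1) is law-fed
(GATE 1a-1 §4 modulo (D-C)(D-Δ)(D-H) at `t = 0`), rows (2)(3) are census-law debt.  [U4_Rows ← U3_Laws, U2G_Census, U2H_HSide]
PAID BY NAME (ED. 4): ★ p857318 `pieceRowsWild_gselStar_zero_of hU3 hDH hDG` with `hU3` := ★ p857343 (U3 closed), `hDH` := ★ p858613 (U2H closed; :418 ← ★ p858565), `hDG` := ★ `anchorCountDictionary_zero` (U2G closed); statement TEXT∕TYPE UNCHANGED (body swap only). -/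
theorem stub_rows_unit0 : PieceRowsWild gselStar 0 :=
  Summit.HodgeConjecture.HodgeConjecture.Cruxes.H413.F0P3cDyRamPieceRowsWildUnit0OfExports.pieceRowsWild_gselStar_zero_of
    Summit.HodgeConjecture.HodgeConjecture.Cruxes.H413.F0P3cDyRamFourFrameLawsWildOfRecordR2.fourFrameLawsWildOfRecordR2_omegaR
    Summit.HodgeConjecture.HodgeConjecture.Cruxes.H413.F0P3cDyRamHSideAnchorRowsRUnit0OfRecord.hSideAnchorRowsR_unit0_ofRecord
    Summit.HodgeConjecture.HodgeConjecture.Cruxes.H413.F0P3cDyRamAnchorCountDictionaryZero.anchorCountDictionary_zero  -- PAID (ED. 4): (R-24)(a) ★ p857318 ∘ (b) ★ p857343 ∘ (c) ★ p858613 ∘ U2G ★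

/-! ### ED. 5 — THE TYPED SPLIT BY COMPOSITION of rows `transvMinus` ∕ `regular` ((R-29)(b)): six registered stubs = the six open hypothesis letters of the ★ junctions
`F0P3cDyRamTierZeroRowsTwoThreeOfLevels.pieceRowsWild_gselStar_two_of_fencedLaws_of_hsides` ∕ `…three_of_fencedLaw_of_hside` at the tokens of record
`shift := shiftR`, `Ω := omegaR`, `N₀ := depthOfRecord`, `Alo := amplCs`, `Ahi := amplLevHi`, `Asq := amplCs` (DEFS LEAF №5; ONE amplitude NAME PER BODY `amplCs` — T19-35 (r-a), dealer WORD #54). -/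

/-- (L-lev-lo) · THE FENCED κ-SIGNED CENSUS LAW OF THE LOWER SHELL-HALF LEVELS PIECE `𝟙_{K_{ℓ₀, m*}}` at the schedules of record (`laLowOfRecord`, `mstarOfRecord`, exponent ∕ B-shift
`csOfRecord`).  Producer F0P3a-p01 (g35): (L-lev-0) `LevLowEqSqAt` + LH4-p12 (g7) (L-sq-K) ⟹ this (v6 §3 `levKappaSum_low_eq_of_levLowEqSq`).
EVIDENCE (T19-35 (r-d); REF1 BOX #247 (b)(c)): fit of record F1 40∕40 ∕ F3 33∕33 + TEMPLATE 0e5ec958 on `d ≤ 3` (q = 2; q = 4 spot); magnitudes LH4-r01 BOX LQ;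
signs REF5 R5-274 = the unit's `ε_i` in R2 currency (`Ω K σ ϖ d a b i · baseSign · normSign`) ABOVE the fence `n0CleanOfRecord` (T19-32 (e) discharged, T19-34 (2));
`d ≥ 4`: the exponents∕shifts = ★ p859102 Levi fibre-volume exponents for EVERY `d` (forced-Levi-law identity), the κ-sign law itself a PREDICTION there (kit ask d = 4, 5 OPEN — a miss re-letters the schedule, not the split); ℕ-truncation of `k − shift d` at 0 = the ★ №1-R2 convention.  PAID BY NAME (ED. 8): `F0P3cDyRamLevKappaSignLawsOfRecord.dyadicFence_levKappaSignLawAtS2_lo_ofRecord'` — statement UNCHANGED, theorem line. -/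
theorem stub_law_levLo : ∀ {K : Type} [Field K] [Valued K ℤᵐ⁰] [CompleteSpace K] [Fintype (Valued.ResidueField K)] (σ : K →+* K) (ϖ : K) (d t : ℕ),
    DyadicFence (K := K) (LevKappaSignLawAtS2 shiftR omegaR depthOfRecord laLowOfRecord mstarOfRecord csOfRecord csOfRecord σ ϖ d t) :=
  F0P3cDyRamLevKappaSignLawsOfRecord.dyadicFence_levKappaSignLawAtS2_lo_ofRecord'

/-- (H-lev-lo) · THE H-SIDE CLOSED-FORM TRIPLE of `𝟙_{K_{ℓ₀, m*}}` (rows (1)(2)(3); two-germ rigidity: `∃ r ψ coef`, no third profile).  Producer LH4-p06 (g6) (coefficients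
`coefAffine(cA,cB)` over `hFamily`; row (2) organ LH4-p07 (g8) (T5-P-axis ★ p859438) ∕ LH4-p04 (g7) (C2-lev), row (3) organ LH4-p08 (g7) ★ `LevelsLeviRow`).
NON-VACUITY (T19-35 (r-c)): the triple is not inhabited by `ψ = 0` or a degenerate `coef` — rows (1)–(3) pin the G-side census of the piece, non-zero above the fence;
PAYER by name: LH4-p06 (g6) assembly vehicle `hSideLevels_hFamily_of_rows` (`ψ := hFamily`, `coef := coefAffine`) fed by the row organs.  PAID BY NAME (ED. 9): `F0P3cDyRamHSideStubsOfLevelsCensusLaw.hSideLevelsTripleS_lo_ofRecord F0P3cDyRamHSideStubsOfRecord.hEnd_ofRecord` (★ D2 p860744 head AT ★ p861872 `hEnd_ofRecord`) — statement UNCHANGED, theorem line. -/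
theorem stub_hside_levLo : HSideLevelsTripleS shiftR omegaR depthOfRecord laLowOfRecord mstarOfRecord amplCs :=
  F0P3cDyRamHSideStubsOfLevelsCensusLaw.hSideLevelsTripleS_lo_ofRecord F0P3cDyRamHSideStubsOfRecord.hEnd_ofRecord

/-- (L-lev-hi) · THE FENCED κ-SIGNED CENSUS LAW OF THE UPPER SHELL-HALF LEVELS PIECE `𝟙_{K_{ℓ₀+1, m*}}` (`laHighOfRecord`, `mstarOfRecord`, `klOfRecord`, `blOfRecord`) =
F0P3a-p01 (g35∕g36) TARGET (L-lev-K) `dyadicFence_levKappaSignLawAtS2_high_ofRecord` VERBATIM.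
EVIDENCE (T19-35 (r-d); REF1 BOX #247 (b)(c)): fit of record F1 40∕40 ∕ F3 33∕33 + TEMPLATE 0e5ec958 on `d ≤ 3` (q = 2; q = 4 spot); magnitudes LH4-r01 BOX LQ;
signs REF5 R5-274 = the unit's `ε_i` in R2 currency (`Ω K σ ϖ d a b i · baseSign · normSign`) ABOVE the fence `n0CleanOfRecord` (T19-32 (e) discharged, T19-34 (2));
`d ≥ 4`: the exponents∕shifts = ★ p859102 Levi fibre-volume exponents for EVERY `d` (forced-Levi-law identity), the κ-sign law itself a PREDICTION there (kit ask d = 4, 5 OPEN — a miss re-letters the schedule, not the split); ℕ-truncation of `k − shift d` at 0 = the ★ №1-R2 convention.  PAID BY NAME (ED. 8): `F0P3cDyRamLevKappaSignLawsOfRecord.dyadicFence_levKappaSignLawAtS2_hi_ofRecord'` — statement UNCHANGED, theorem line. -/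
theorem stub_law_levHi : ∀ {K : Type} [Field K] [Valued K ℤᵐ⁰] [CompleteSpace K] [Fintype (Valued.ResidueField K)] (σ : K →+* K) (ϖ : K) (d t : ℕ),
    DyadicFence (K := K) (LevKappaSignLawAtS2 shiftR omegaR depthOfRecord laHighOfRecord mstarOfRecord klOfRecord blOfRecord σ ϖ d t) :=
  F0P3cDyRamLevKappaSignLawsOfRecord.dyadicFence_levKappaSignLawAtS2_hi_ofRecord'

/-- (H-lev-hi) · THE H-SIDE CLOSED-FORM TRIPLE of `𝟙_{K_{ℓ₀+1, m*}}` (row (2) organ LH4-p07 (g8) ∕ LH4-p04 (g7), row (3) organ LH4-p08 (g7)).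
NON-VACUITY (T19-35 (r-c)): the triple is not inhabited by `ψ = 0` or a degenerate `coef` — rows (1)–(3) pin the G-side census of the piece, non-zero above the fence;
PAYER by name: LH4-p06 (g6) assembly vehicle `hSideLevels_hFamily_of_rows` (`ψ := hFamily`, `coef := coefAffine`) fed by the row organs.  PAID BY NAME (ED. 9): `F0P3cDyRamHSideStubsOfLevelsCensusLaw.hSideLevelsTripleS_hi_ofRecord F0P3cDyRamHSideStubsOfRecord.hEnd_ofRecord` (★ D2 p860744 head AT ★ p861872 `hEnd_ofRecord`) — statement UNCHANGED, theorem line. -/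
theorem stub_hside_levHi : HSideLevelsTripleS shiftR omegaR depthOfRecord laHighOfRecord mstarOfRecord amplLevHi :=
  F0P3cDyRamHSideStubsOfLevelsCensusLaw.hSideLevelsTripleS_hi_ofRecord F0P3cDyRamHSideStubsOfRecord.hEnd_ofRecord

/-- (L-sq) · THE FENCED κ-SIGNED CENSUS LAW OF THE SQUARE-LEVEL PIECE `𝟙{X² ∈ ϖ^{m*}M₃}` (`csOfRecord`) = LH4-p12 (g7) TARGET (L-sq-K) `dyadicFence_sqKappaSignLawAtS2_ofRecord`
VERBATIM.
EVIDENCE (T19-35 (r-d); REF1 BOX #247 (b)(c)): fit of record F1 40∕40 ∕ F3 33∕33 + TEMPLATE 0e5ec958 on `d ≤ 3` (q = 2; q = 4 spot); magnitudes LH4-r01 BOX LQ;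
signs REF5 R5-274 = the unit's `ε_i` in R2 currency (`Ω K σ ϖ d a b i · baseSign · normSign`) ABOVE the fence `n0CleanOfRecord` (T19-32 (e) discharged, T19-34 (2));
`d ≥ 4`: the exponents∕shifts = ★ p859102 Levi fibre-volume exponents for EVERY `d` (forced-Levi-law identity), the κ-sign law itself a PREDICTION there (kit ask d = 4, 5 OPEN — a miss re-letters the schedule, not the split); ℕ-truncation of `k − shift d` at 0 = the ★ №1-R2 convention.  PAID BY NAME (ED. 7): `F0P3cDyRamSqKappaSignLawOfBoxSum.dyadicFence_sqKappaSignLawAtS2_ofRecord` — statement UNCHANGED, theorem line. -/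
theorem stub_law_sq : ∀ {K : Type} [Field K] [Valued K ℤᵐ⁰] [CompleteSpace K] [Fintype (Valued.ResidueField K)] (σ : K →+* K) (ϖ : K) (d t : ℕ),
    DyadicFence (K := K) (SqKappaSignLawAtS2 shiftR omegaR depthOfRecord csOfRecord σ ϖ d t) :=
  F0P3cDyRamSqKappaSignLawOfBoxSum.dyadicFence_sqKappaSignLawAtS2_ofRecord

/-- (H-sq) · THE H-SIDE CLOSED-FORM TRIPLE of the square-level piece at `m*`.  Producer LH4-p06 (g6) (row (3): regular fibre volume ★ p859150, LH4-p10 (g5)).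
NON-VACUITY (T19-35 (r-c)): the triple is not inhabited by `ψ = 0` or a degenerate `coef` — rows (1)–(3) pin the G-side census of the piece, non-zero above the fence;
PAYER by name: LH4-p06 (g6) assembly vehicle `hSideLevels_hFamily_of_rows` (`ψ := hFamily`, `coef := coefAffine`) fed by the row organs.  PAID BY NAME (ED. 9): `F0P3cDyRamHSideStubsOfLevelsCensusLaw.hSideSqTripleS_ofRecord F0P3cDyRamHSideStubsOfRecord.hEnd_ofRecord` (★ D2 p860744 head AT ★ p861872 `hEnd_ofRecord`) — statement UNCHANGED, theorem line. -/
theorem stub_hside_sq : HSideSqTripleS shiftR omegaR depthOfRecord mstarOfRecord amplCs :=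
  F0P3cDyRamHSideStubsOfLevelsCensusLaw.hSideSqTripleS_ofRecord F0P3cDyRamHSideStubsOfRecord.hEnd_ofRecord

/-! ### ED. 6 — ROW `T₊` DERIVED: THE TYPED SPLIT BY COMPOSITION ((R-29)(b); D-1b §4; T19-40 (R-30)): four registered stubs + the (α′) line PAID BY NAME = the hypothesis letters of
★ `F0P3cDyRamHSideTransvPlusGuarded.pieceRowsWild_gselStar_one_of_fencedLaw_of_rows` ∘ ★ `F0P3cDyRamTransvPlusLawOfCleanLevels.transvPlusLawTargetDerived_of`
at the tokens of record `shift := shiftR`, `Ω := omegaR`, `N₀ := n0DerivedOfRecord`, `A := amplTransvPlusDerived` (DEFS LEAF №6 ★ p859675): the (L-T+) law is NOT primary — it is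
DERIVED from the two CLEAN-LEVEL laws (amplitudes `amplShift sT sT`, `amplShift (sT+1) (sT−1)`) + (α′) label ⇒ clean + (β) clean sign frame-constant (heir LEAD T19-32: «no primary
(L-T+) letter»; dead primary routes: `amplShift 5 2` at (7,7,13), pointwise (α) — F0P3-p01 10:15Z∕10:26Z). -/

/-- (L-T+-lo) · THE FENCED κ-SIGNED CENSUS LAW OF THE LOWER CLEAN-LEVEL PIECE `𝟙_{K_{ℓ₀, m_c}}` (`laLowOfRecord`, `mcOfRecord`, amplitude `amplShift sTOfRecord sTOfRecord`,
threshold `n0DerivedOfRecord`).  Producer F0P3a-p01 (L-lev) lane at label level `mcOfRecord` ((L2c) engine ★ p859645 ∘ (L2b-κS) censuses).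
FIT OF RECORD (T19-40 (R-30)(3)(i)): F0P3-p01 (g35) (L-T+) RE-FIT `refit/REFIT-Tplus.v1` f25b87caf80635e8 READ AS TWO CLEAN-LEVEL LAWS — |κ(T₊)| = ½|ampl(k−s,B−s) − ampl(k−s−1,B−s+1)|,
s = sTOfRecord d, 27∕27 (R-U 9∕9 ∕ R-P 16∕16 incl. (7,7,13), (9,11,9), + 2) on `d ≤ 3`; magnitudes LH4-r01 BOX LQ; d = 4 digits: key (8,14,8) exact at (kl, bl) = (3,1);
signs REF5 R5-274 (the derived difference law's sign slot-by-slot = arithmetic of the two level laws' R2 tokens, T19-32 (e)); `d ≥ 4`: exponents = ★ p859102∕★ p859652 Levi exponents,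
the κ-sign law at the clean level `m_c` a PREDICTION (the `m_c = 10` pieces at `d = 4` need keys with min nᵢ ≥ 9 — kit ask OPEN, F0P3-p01 11:05:39Z; a miss re-letters `sT`∕`mc`, not the split).  PAID BY NAME (ED. 8): `F0P3cDyRamLevKappaSignLawsOfRecord.dyadicFence_levKappaSignLawAtS2_cleanLo_ofRecord'` — statement UNCHANGED, theorem line. -/
theorem stub_law_levCleanLo : ∀ {K : Type} [Field K] [Valued K ℤᵐ⁰] [CompleteSpace K] [Fintype (Valued.ResidueField K)] (σ : K →+* K) (ϖ : K) (d t : ℕ),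
    DyadicFence (K := K) (LevKappaSignLawAtS2 shiftR omegaR n0DerivedOfRecord laLowOfRecord mcOfRecord sTOfRecord sTOfRecord σ ϖ d t) :=
  F0P3cDyRamLevKappaSignLawsOfRecord.dyadicFence_levKappaSignLawAtS2_cleanLo_ofRecord'

/-- (L-T+-hi) · THE FENCED κ-SIGNED CENSUS LAW OF THE UPPER CLEAN-LEVEL PIECE `𝟙_{K_{ℓ₀+1, m_c}}` (`laHighOfRecord`, `mcOfRecord`, amplitude `amplShift (sT+1) (sT−1)`).
Producer F0P3a-p01 (L-lev) lane.  FIT OF RECORD (T19-40 (R-30)(3)(i)): F0P3-p01 (g35) (L-T+) RE-FIT `refit/REFIT-Tplus.v1` f25b87caf80635e8 READ AS TWO CLEAN-LEVEL LAWS — |κ(T₊)| = ½|ampl(k−s,B−s) − ampl(k−s−1,B−s+1)|,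
s = sTOfRecord d, 27∕27 (R-U 9∕9 ∕ R-P 16∕16 incl. (7,7,13), (9,11,9), + 2) on `d ≤ 3`; magnitudes LH4-r01 BOX LQ; d = 4 digits: key (8,14,8) exact at (kl, bl) = (3,1);
signs REF5 R5-274 (the derived difference law's sign slot-by-slot = arithmetic of the two level laws' R2 tokens, T19-32 (e)); `d ≥ 4`: exponents = ★ p859102∕★ p859652 Levi exponents,
the κ-sign law at the clean level `m_c` a PREDICTION (the `m_c = 10` pieces at `d = 4` need keys with min nᵢ ≥ 9 — kit ask OPEN, F0P3-p01 11:05:39Z; a miss re-letters `sT`∕`mc`, not the split).  PAID BY NAME (ED. 8): `F0P3cDyRamLevKappaSignLawsOfRecord.dyadicFence_levKappaSignLawAtS2_cleanHi_ofRecord'` — statement UNCHANGED, theorem line. -/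
theorem stub_law_levCleanHi : ∀ {K : Type} [Field K] [Valued K ℤᵐ⁰] [CompleteSpace K] [Fintype (Valued.ResidueField K)] (σ : K →+* K) (ϖ : K) (d t : ℕ),
    DyadicFence (K := K) (LevKappaSignLawAtS2 shiftR omegaR n0DerivedOfRecord laHighOfRecord mcOfRecord (fun d => sTOfRecord d + 1) (fun d => sTOfRecord d - 1) σ ϖ d t) :=
  F0P3cDyRamLevKappaSignLawsOfRecord.dyadicFence_levKappaSignLawAtS2_cleanHi_ofRecord'

/-- (α′) · THE LABEL FORCES THE CLEAN SQUARE LEVEL — near-1, POPULATION-SHAPED (not a pointwise K-wide identity: F0P3-p01 10:26Z erratum, LH4-p13 (g8) witnesses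
10:15Z∕10:33Z): `DyadicFence (LabelPlusCleanLawAt n0DerivedOfRecord mcOfRecord …)` — **PAID BY NAME on arrival (T19-40 (R-30)(2): no stub that is already a theorem)**: ★ LH4-p13 (g8)
`F0P3cDyRamLabelPlusCleanOfRecord.dyadicFence_labelPlusCleanLawAt_derived_ofRecord` ((L-lab-15) ∘ ★ p859653 (L-lab-14) HEAD `latticeInLevel_sq_of_shell_of_labelPlus_ofRecord` under the fence `mc d ≤ N₀ d + d % 2`,
which `n0DerivedOfRecord` satisfies at every `d` — ★ p859675 `mcOfRecord_le_n0DerivedOfRecord_add`).  A DERIVED line: statement = the (α′) hypothesis letter of ★ `F0P3cDyRamTransvPlusLawOfCleanLevels.transvPlusLawTargetDerived_of`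
VERBATIM, so the pay line below cites it by name like a stub.  NAME ⊕ NAME. -/
theorem stub_law_labelClean : ∀ {K : Type} [Field K] [Valued K ℤᵐ⁰] [CompleteSpace K] [Fintype (Valued.ResidueField K)] (σ : K →+* K) (ϖ : K) (d t : ℕ),
    DyadicFence (K := K) (LabelPlusCleanLawAt n0DerivedOfRecord mcOfRecord σ ϖ d t) :=
  F0P3cDyRamLabelPlusCleanOfRecord.dyadicFence_labelPlusCleanLawAt_derived_ofRecord

/-- (β) · THE CLEAN SIGN CENSUS IS FRAME-CONSTANT: `DyadicFence (CleanSgnFrameConstLawAt n0DerivedOfRecord mcOfRecord …)`.  Producer LH4-p05 (g8) (model form first: per diagonal-model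
stratum the `+`∕`−′` split is frame-independent up to the class of `c_i^(b)`; engines ★ p859223 (LH4-p13), ★ p858861∕p858900 (LH4-p09)).  NON-VACUITY ∕ NON-CIRCULARITY: B1 box
(chair LH4-r01 ∕ REF5) on the producer's statement-first file; data tie F0P3-p01 TEMPLATE-LAWS §2 at d = 2, 3.  PAID BY NAME (ED. 10): `F0P3cDyRamCleanSgnOfRecord.cleanSgn_ofRecord` — statement UNCHANGED, theorem line. -/
theorem stub_law_cleanSgn : ∀ {K : Type} [Field K] [Valued K ℤᵐ⁰] [CompleteSpace K] [Fintype (Valued.ResidueField K)] (σ : K →+* K) (ϖ : K) (d t : ℕ),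
    DyadicFence (K := K) (CleanSgnFrameConstLawAt n0DerivedOfRecord mcOfRecord σ ϖ d t) :=
  F0P3cDyRamCleanSgnOfRecord.cleanSgn_ofRecord

/-- (β)₂ · THE TYPE-(2) CLEAN-SHELL LABEL BALANCE `β₂` — DIFFERENCE FORM: per type-(2) place, per square datum, the label-`+` excess over label-`−′` on the clean shell
`(m*, m_c)` is the SAME for the two type-(2) literals (`cleanPlusFixCount − cleanMinusFixCount` at `δ = δp` equals the same difference at `δ = δm`).  STATEMENT = LH4-p04 (g7)
`betaT2.letter.v1` (sha16 cd9aa77b0adaf5ee) VERBATIM, its one integer-ring letter `_h2` spelled `Valued.integer (w.1.adicCompletion L)` — the reading ★ D3 p860783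
`F0P3cDyRamTransvPlusHSideOfRecord.hSideRows_transvPlus_ofRecord (hβ₂)` and ★ p860151 `hDelta_ofRecord` consume, so the T₊ pay line plugs ON THE NOSE (this file's other `_h2` letters
read `𝒪[·]` under `ValuativeRel`; bridge ★ `isUnit_two_valuationInteger_iff`).  WHY A STUB ((R-33) addendum, heir LEAD TIER 14:20Z; desk ISSUE 21 shape (A′); dealer PEN #13): after
the RamM socket `levelsCensusC` the T₊ H-side row `stub_hside_transvPlus` is EXACTLY `‹D3′› β₂` — the row is re-lined 1 → 1 onto this one letter, so the module's open debt reads as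
what it is.  PAYER (rule 72 ∕ (R-26); T19-35 (r-c)): LH4-p04 (g8) (S4) PLACE ASSEMBLY over (S-1) ★ p860690 `…NormFibreTransport` (per-cell GENERIC balance), (S-2) label transport
(★ p860795 `…GlueLabelNormBlind` ×2 + F0P3-p01 (g36) GLUEFIBRE 91d9b231: labels fibre-constant), (β₂-H) SPECIFIC cells LH4-p09 (g9) ★ p860765∕p860795∕p860839 + the face
«label(Λ₀) = s(cell)·χ(N(gen Λ₀))»; chair LH4-r01 (g9) 14:10:09Z junction tie (D3's `hβ₂` body ≡ the letter, 0 ops).  NON-VACUITY: the hypotheses are the T₊ row's own (type-(2)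
place, `IsRamifiedQuadraticDatum`, unitary CM character) — inhabited at every ramified place of record; the two differences are each NON-ZERO in general (truth table: ℚ₂(√2)
c = −1 key (9,7) offset −64 on both literals), so the letter is not an instance of `0 = 0`.  TRUTH-INSTANCES ((r-d); (R-31) ★-booking gate; heir LEAD T20-12 (d) text): F0P3-p01 (g35) `refit/beta2.table.F0P3p01g35.txt` sha16 426f8f0009ac0538 (TYPE (2),
clean-capped): offset₁ = offset₂ at 36∕36 element×coset rows — ℚ₂(√2) (3,2) keys (5,3,3), (7,5,5), (9,7,7), (11,10,10); ℚ₂(i) (2,2) keys (4,2,2), (6,4,4), (8,6,6), (10,10,10)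
[rows at or above `n0DerivedOfRecord` on every depth: (11,10,10); (6,4,4), (8,6,6), (10,10,10)]; the STRONG per-literal form «T₊ = T−′_clean» is FALSE in THAT table at (9,7,7)
(offsets ±64, two elements) and (10,10,10) (−512) — hence the difference form (the type-(1) «c = 0» refutations belong to `refit/beta.table.F0P3p01g35.txt` 1b118abb2ab06792 =
(β) `stub_law_cleanSgn`, not to β₂).  FAILURE MODE: one populated SPECIFIC cell with
unbalanced labels re-letters β₂ to the weighted form of SCOPE-beta2 v2 bd85a13a §3 — the letter, not the row.  STAGE-1b debt — `sorry`. -/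
theorem stub_law_cleanSgn₂ :
      ∀ (L : Type) [Field L] [NumberField L] [IsCMField L]
        {v : HeightOneSpectrum (𝓞 ↥(maximalRealSubfield L))} (w : UnitaryGroup.PlacesOver L v)
        (hw : IsCMField.complexConj L • w.1 = w.1) (_he : v.asIdeal.ramificationIdx' w.1.asIdeal ≠ 1)
        (_h2 : ¬ IsUnit (2 : Valued.integer (w.1.adicCompletion L)))
        (ϖ : (w.1.adicCompletion L)) (_hϖ : Valued.v ϖ = WithZero.exp (-1 : ℤ)) (d tE : ℕ) (_hD : IsRamifiedQuadraticDatum (galAdicCompletionMap (L := L) (IsCMField.complexConj L) hw) ϖ d tE)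
        [Fintype (Valued.ResidueField (w.1.adicCompletion L))] (δ : (w.1.adicCompletion L)) (_hδ : (galAdicCompletionMap (L := L) (IsCMField.complexConj L) hw) δ = -δ) (_hδ0 : δ ≠ 0)
        (μ : HeckeCharacter L) (_hμu : μ.IsUnitary)
        (_hμω : ∀ x : ideleGroup ↥(maximalRealSubfield L), μ (AdeleRing.ideleBaseChange ↥(maximalRealSubfield L) L x) = quadraticHeckeCharCM L x)
        [MeasurableSpace ((UnitaryGroup.cmDatum L 3 (Matrix.of fun i j : Fin 3 => if i.val + j.val + 1 = 3 then (1 : L) else 0)).Local v)] [BorelSpace ((UnitaryGroup.cmDatum L 3 (Matrix.of fun i j : Fin 3 => if i.val + j.val + 1 = 3 then (1 : L) else 0)).Local v)]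
        [∀ γ : ((UnitaryGroup.cmDatum L 3 (Matrix.of fun i j : Fin 3 => if i.val + j.val + 1 = 3 then (1 : L) else 0)).Local v), MeasurableSpace (((UnitaryGroup.cmDatum L 3 (Matrix.of fun i j : Fin 3 => if i.val + j.val + 1 = 3 then (1 : L) else 0)).Local v) ⧸ Subgroup.centralizer ({γ} : Set ((UnitaryGroup.cmDatum L 3 (Matrix.of fun i j : Fin 3 => if i.val + j.val + 1 = 3 then (1 : L) else 0)).Local v)))]
        [∀ γ : ((UnitaryGroup.cmDatum L 3 (Matrix.of fun i j : Fin 3 => if i.val + j.val + 1 = 3 then (1 : L) else 0)).Local v), BorelSpace (((UnitaryGroup.cmDatum L 3 (Matrix.of fun i j : Fin 3 => if i.val + j.val + 1 = 3 then (1 : L) else 0)).Local v) ⧸ Subgroup.centralizer ({γ} : Set ((UnitaryGroup.cmDatum L 3 (Matrix.of fun i j : Fin 3 => if i.val + j.val + 1 = 3 then (1 : L) else 0)).Local v)))]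
        [MeasurableSpace ((UnitaryGroup.cmDatum L 2 (Matrix.of fun i j : Fin 2 => if i.val + j.val + 1 = 2 then (1 : L) else 0)).Local v × (UnitaryGroup.cmDatum L 1 (Matrix.of fun i j : Fin 1 => if i.val + j.val + 1 = 1 then (1 : L) else 0)).Local v)] [BorelSpace ((UnitaryGroup.cmDatum L 2 (Matrix.of fun i j : Fin 2 => if i.val + j.val + 1 = 2 then (1 : L) else 0)).Local v × (UnitaryGroup.cmDatum L 1 (Matrix.of fun i j : Fin 1 => if i.val + j.val + 1 = 1 then (1 : L) else 0)).Local v)]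
        [∀ a : ((UnitaryGroup.cmDatum L 2 (Matrix.of fun i j : Fin 2 => if i.val + j.val + 1 = 2 then (1 : L) else 0)).Local v × (UnitaryGroup.cmDatum L 1 (Matrix.of fun i j : Fin 1 => if i.val + j.val + 1 = 1 then (1 : L) else 0)).Local v), MeasurableSpace (((UnitaryGroup.cmDatum L 2 (Matrix.of fun i j : Fin 2 => if i.val + j.val + 1 = 2 then (1 : L) else 0)).Local v × (UnitaryGroup.cmDatum L 1 (Matrix.of fun i j : Fin 1 => if i.val + j.val + 1 = 1 then (1 : L) else 0)).Local v) ⧸ Subgroup.centralizer ({a} : Set ((UnitaryGroup.cmDatum L 2 (Matrix.of fun i j : Fin 2 => if i.val + j.val + 1 = 2 then (1 : L) else 0)).Local v × (UnitaryGroup.cmDatum L 1 (Matrix.of fun i j : Fin 1 => if i.val + j.val + 1 = 1 then (1 : L) else 0)).Local v)))]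
        [∀ a : ((UnitaryGroup.cmDatum L 2 (Matrix.of fun i j : Fin 2 => if i.val + j.val + 1 = 2 then (1 : L) else 0)).Local v × (UnitaryGroup.cmDatum L 1 (Matrix.of fun i j : Fin 1 => if i.val + j.val + 1 = 1 then (1 : L) else 0)).Local v), BorelSpace (((UnitaryGroup.cmDatum L 2 (Matrix.of fun i j : Fin 2 => if i.val + j.val + 1 = 2 then (1 : L) else 0)).Local v × (UnitaryGroup.cmDatum L 1 (Matrix.of fun i j : Fin 1 => if i.val + j.val + 1 = 1 then (1 : L) else 0)).Local v) ⧸ Subgroup.centralizer ({a} : Set ((UnitaryGroup.cmDatum L 2 (Matrix.of fun i j : Fin 2 => if i.val + j.val + 1 = 2 then (1 : L) else 0)).Local v × (UnitaryGroup.cmDatum L 1 (Matrix.of fun i j : Fin 1 => if i.val + j.val + 1 = 1 then (1 : L) else 0)).Local v)))]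
        (νH : Measure ((UnitaryGroup.cmDatum L 2 (Matrix.of fun i j : Fin 2 => if i.val + j.val + 1 = 2 then (1 : L) else 0)).Local v × (UnitaryGroup.cmDatum L 1 (Matrix.of fun i j : Fin 1 => if i.val + j.val + 1 = 1 then (1 : L) else 0)).Local v)) [νH.IsHaarMeasure] [νH.IsMulRightInvariant]
        (νG₃ : Measure ((UnitaryGroup.cmDatum L 3 (Matrix.of fun i j : Fin 3 => if i.val + j.val + 1 = 3 then (1 : L) else 0)).Local v)) [νG₃.IsHaarMeasure] [νG₃.IsMulRightInvariant]
        (mH : OrbitalMeasureFamily ((UnitaryGroup.cmDatum L 2 (Matrix.of fun i j : Fin 2 => if i.val + j.val + 1 = 2 then (1 : L) else 0)).Local v × (UnitaryGroup.cmDatum L 1 (Matrix.of fun i j : Fin 1 => if i.val + j.val + 1 = 1 then (1 : L) else 0)).Local v)) (mG₃ : OrbitalMeasureFamily ((UnitaryGroup.cmDatum L 3 (Matrix.of fun i j : Fin 3 => if i.val + j.val + 1 = 3 then (1 : L) else 0)).Local v))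
        (_hmH : mH.IsCanonical (IsLocalGRegular L v) νH) (_hmG : mG₃.IsCanonical (fun γ => IsRegularElt (γ.val : GL (Fin 3) (UnitaryGroup.LocalRing L v))) νG₃),
                  (∃ V ∈ 𝓝 (1 : ((UnitaryGroup.cmDatum L 2 (Matrix.of fun i j : Fin 2 => if i.val + j.val + 1 = 2 then (1 : L) else 0)).Local v × (UnitaryGroup.cmDatum L 1 (Matrix.of fun i j : Fin 1 => if i.val + j.val + 1 = 1 then (1 : L) else 0)).Local v)), ∀ γH ∈ V, IsLocalGRegular L v γH →
      ¬ (∃ x : (w.1.adicCompletion L), (((((γH).1.val : GL (Fin 2) (UnitaryGroup.LocalRing L v)).val.map (Pi.evalRingHom (fun w' : UnitaryGroup.PlacesOver L v => w'.1.adicCompletion L) w))).charpoly).IsRoot x) →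
      ∀ δp δm : ((UnitaryGroup.cmDatum L 3 (Matrix.of fun i j : Fin 3 => if i.val + j.val + 1 = 3 then (1 : L) else 0)).Local v), IsLocalNormPair L (Matrix.of fun i j : Fin 3 => if i.val + j.val + 1 = 3 then (1 : L) else 0) v γH δp → finKappaAt L v (Matrix.of fun i j : Fin 3 => if i.val + j.val + 1 = 3 then (1 : L) else 0) γH δp = 1 → IsLocalNormPair L (Matrix.of fun i j : Fin 3 => if i.val + j.val + 1 = 3 then (1 : L) else 0) v γH δm → finKappaAt L v (Matrix.of fun i j : Fin 3 => if i.val + j.val + 1 = 3 then (1 : L) else 0) γH δm = -1 →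
        (transvPlusFixCount (galAdicCompletionMap (L := L) (IsCMField.complexConj L) hw) ϖ d (d % 2) (mstarOfRecord d) ((localNonsplitEquiv (IsCMField.complexConj L) (Matrix.of fun i j : Fin 3 => if i.val + j.val + 1 = 3 then (1 : L) else 0) (IsCMField.complexConj_ne_one L) w hw δp :
              ↥(unitaryGroupOfForm (galAdicCompletionMap (L := L) (IsCMField.complexConj L) hw) (placeForm (Matrix.of fun i j : Fin 3 => if i.val + j.val + 1 = 3 then (1 : L) else 0) w.1))) : GL (Fin 3) (w.1.adicCompletion L)) : ℤ) -
            (cleanMinusFixCount (galAdicCompletionMap (L := L) (IsCMField.complexConj L) hw) ϖ d (d % 2) (mstarOfRecord d) (mcOfRecord d) ((localNonsplitEquiv (IsCMField.complexConj L) (Matrix.of fun i j : Fin 3 => if i.val + j.val + 1 = 3 then (1 : L) else 0) (IsCMField.complexConj_ne_one L) w hw δp :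
              ↥(unitaryGroupOfForm (galAdicCompletionMap (L := L) (IsCMField.complexConj L) hw) (placeForm (Matrix.of fun i j : Fin 3 => if i.val + j.val + 1 = 3 then (1 : L) else 0) w.1))) : GL (Fin 3) (w.1.adicCompletion L)) : ℤ) =
          (transvPlusFixCount (galAdicCompletionMap (L := L) (IsCMField.complexConj L) hw) ϖ d (d % 2) (mstarOfRecord d) ((localNonsplitEquiv (IsCMField.complexConj L) (Matrix.of fun i j : Fin 3 => if i.val + j.val + 1 = 3 then (1 : L) else 0) (IsCMField.complexConj_ne_one L) w hw δm :
              ↥(unitaryGroupOfForm (galAdicCompletionMap (L := L) (IsCMField.complexConj L) hw) (placeForm (Matrix.of fun i j : Fin 3 => if i.val + j.val + 1 = 3 then (1 : L) else 0) w.1))) : GL (Fin 3) (w.1.adicCompletion L)) : ℤ) -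
            (cleanMinusFixCount (galAdicCompletionMap (L := L) (IsCMField.complexConj L) hw) ϖ d (d % 2) (mstarOfRecord d) (mcOfRecord d) ((localNonsplitEquiv (IsCMField.complexConj L) (Matrix.of fun i j : Fin 3 => if i.val + j.val + 1 = 3 then (1 : L) else 0) (IsCMField.complexConj_ne_one L) w hw δm :
              ↥(unitaryGroupOfForm (galAdicCompletionMap (L := L) (IsCMField.complexConj L) hw) (placeForm (Matrix.of fun i j : Fin 3 => if i.val + j.val + 1 = 3 then (1 : L) else 0) w.1))) : GL (Fin 3) (w.1.adicCompletion L)) : ℤ)) := by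
  sorry

/-- (H-T+) · THE THREE NUMBER-LETTERS OF `f_{T+}` PER PLACE (`∃ cA cB N₁, hA ∧ hG₂ ∧ hnum` = ★ `F0P3cDyRamHSideTransvPlusGuarded.pieceRowsWild_gselStar_one_of_fencedLaw_of_rows`'s `hrows` binder — form (A′): the hA letter carries the two ROOT GUARDS `Valued.v (a - 1) < Valued.v 2 → Valued.v (b - 1) < Valued.v 2 →` after `b * σ b = 1 →` (LH4-p14 (g6) 11:37:57Z flag: unguarded, `omegaR … a b 2 = glueSign (b∕a)` flips under `a ↦ −a` wherever `−1 ∉ N(L_w^×)` and the letter is FALSE; r01 BOX MT, REF5 R5-282)): row (1) token arithmetic `hA` (★ p859613 (V9) at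
`C := νG₃(K).toReal`), row (2) the type-(2) census of `f_{T+}` in X-currency `hG₂` (= half-difference of the two clean-level censuses: LH4-p04 (g7) (C2-lev-X) at `mcOfRecord` ∘
LH4-p07 (g9) cone), row (3) the Levi scalar `hnum` (★ p859539 exact, LH4-p08 lineage).  Producer LH4-p14 (g6) ((H-T+) assembly ★ `F0P3cDyRamHSideTransvPlusGuarded.hSideTransvPlus_hFamily_of_rows`; Ω-coverage on
GUARDED square data `2d − 1 + t_E ≤ n₃ ⇒ omegaR … 2 = 1` by ★ `glueSign_eq_one_of_v_sub_one_le` inside `∃ N₁` per place — a PROVED covered-cell instance, no Ω letter (T19-40 (R-30)(1))).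
NON-VACUITY: two-germ rigidity — `(hFamily, coefAffine(cA,cB))`, no third profile; rows (1)–(3) pin the G-side census of the piece.  RE-LINED 1 → 1 ONTO β₂ (ED. 9, (R-33) addendum): `F0P3cDyRamHSideStubsOfRecord.hSideRows_transvPlus_ofRecord' stub_law_cleanSgn₂` — statement UNCHANGED, theorem line; the row's one remaining letter is the typed stub `stub_law_cleanSgn₂` (β₂). -/
theorem stub_hside_transvPlus :
      ∀ (L : Type) [Field L] [NumberField L] [IsCMField L]
        {v : HeightOneSpectrum (𝓞 ↥(maximalRealSubfield L))} (w : UnitaryGroup.PlacesOver L v)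
        (hw : IsCMField.complexConj L • w.1 = w.1) (_he : v.asIdeal.ramificationIdx' w.1.asIdeal ≠ 1)
        (_h2 : ¬ IsUnit (2 : 𝒪[w.1.adicCompletion L]))
        (ϖ : (w.1.adicCompletion L)) (_hϖ : Valued.v ϖ = WithZero.exp (-1 : ℤ)) (d tE : ℕ) (_hD : IsRamifiedQuadraticDatum (galAdicCompletionMap (L := L) (IsCMField.complexConj L) hw) ϖ d tE)
        [Fintype (Valued.ResidueField (w.1.adicCompletion L))] (δ : (w.1.adicCompletion L)) (_hδ : (galAdicCompletionMap (L := L) (IsCMField.complexConj L) hw) δ = -δ) (_hδ0 : δ ≠ 0)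
        (μ : HeckeCharacter L) (_hμu : μ.IsUnitary)
        (_hμω : ∀ x : ideleGroup ↥(maximalRealSubfield L), μ (AdeleRing.ideleBaseChange ↥(maximalRealSubfield L) L x) = quadraticHeckeCharCM L x)
        [MeasurableSpace ((UnitaryGroup.cmDatum L 3 (Matrix.of fun i j : Fin 3 => if i.val + j.val + 1 = 3 then (1 : L) else 0)).Local v)] [BorelSpace ((UnitaryGroup.cmDatum L 3 (Matrix.of fun i j : Fin 3 => if i.val + j.val + 1 = 3 then (1 : L) else 0)).Local v)]
        [∀ γ : ((UnitaryGroup.cmDatum L 3 (Matrix.of fun i j : Fin 3 => if i.val + j.val + 1 = 3 then (1 : L) else 0)).Local v), MeasurableSpace (((UnitaryGroup.cmDatum L 3 (Matrix.of fun i j : Fin 3 => if i.val + j.val + 1 = 3 then (1 : L) else 0)).Local v) ⧸ Subgroup.centralizer ({γ} : Set ((UnitaryGroup.cmDatum L 3 (Matrix.of fun i j : Fin 3 => if i.val + j.val + 1 = 3 then (1 : L) else 0)).Local v)))]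
        [∀ γ : ((UnitaryGroup.cmDatum L 3 (Matrix.of fun i j : Fin 3 => if i.val + j.val + 1 = 3 then (1 : L) else 0)).Local v), BorelSpace (((UnitaryGroup.cmDatum L 3 (Matrix.of fun i j : Fin 3 => if i.val + j.val + 1 = 3 then (1 : L) else 0)).Local v) ⧸ Subgroup.centralizer ({γ} : Set ((UnitaryGroup.cmDatum L 3 (Matrix.of fun i j : Fin 3 => if i.val + j.val + 1 = 3 then (1 : L) else 0)).Local v)))]
        [MeasurableSpace ((UnitaryGroup.cmDatum L 2 (Matrix.of fun i j : Fin 2 => if i.val + j.val + 1 = 2 then (1 : L) else 0)).Local v × (UnitaryGroup.cmDatum L 1 (Matrix.of fun i j : Fin 1 => if i.val + j.val + 1 = 1 then (1 : L) else 0)).Local v)] [BorelSpace ((UnitaryGroup.cmDatum L 2 (Matrix.of fun i j : Fin 2 => if i.val + j.val + 1 = 2 then (1 : L) else 0)).Local v × (UnitaryGroup.cmDatum L 1 (Matrix.of fun i j : Fin 1 => if i.val + j.val + 1 = 1 then (1 : L) else 0)).Local v)]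
        [∀ a : ((UnitaryGroup.cmDatum L 2 (Matrix.of fun i j : Fin 2 => if i.val + j.val + 1 = 2 then (1 : L) else 0)).Local v × (UnitaryGroup.cmDatum L 1 (Matrix.of fun i j : Fin 1 => if i.val + j.val + 1 = 1 then (1 : L) else 0)).Local v), MeasurableSpace (((UnitaryGroup.cmDatum L 2 (Matrix.of fun i j : Fin 2 => if i.val + j.val + 1 = 2 then (1 : L) else 0)).Local v × (UnitaryGroup.cmDatum L 1 (Matrix.of fun i j : Fin 1 => if i.val + j.val + 1 = 1 then (1 : L) else 0)).Local v) ⧸ Subgroup.centralizer ({a} : Set ((UnitaryGroup.cmDatum L 2 (Matrix.of fun i j : Fin 2 => if i.val + j.val + 1 = 2 then (1 : L) else 0)).Local v × (UnitaryGroup.cmDatum L 1 (Matrix.of fun i j : Fin 1 => if i.val + j.val + 1 = 1 then (1 : L) else 0)).Local v)))]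
        [∀ a : ((UnitaryGroup.cmDatum L 2 (Matrix.of fun i j : Fin 2 => if i.val + j.val + 1 = 2 then (1 : L) else 0)).Local v × (UnitaryGroup.cmDatum L 1 (Matrix.of fun i j : Fin 1 => if i.val + j.val + 1 = 1 then (1 : L) else 0)).Local v), BorelSpace (((UnitaryGroup.cmDatum L 2 (Matrix.of fun i j : Fin 2 => if i.val + j.val + 1 = 2 then (1 : L) else 0)).Local v × (UnitaryGroup.cmDatum L 1 (Matrix.of fun i j : Fin 1 => if i.val + j.val + 1 = 1 then (1 : L) else 0)).Local v) ⧸ Subgroup.centralizer ({a} : Set ((UnitaryGroup.cmDatum L 2 (Matrix.of fun i j : Fin 2 => if i.val + j.val + 1 = 2 then (1 : L) else 0)).Local v × (UnitaryGroup.cmDatum L 1 (Matrix.of fun i j : Fin 1 => if i.val + j.val + 1 = 1 then (1 : L) else 0)).Local v)))]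
        (νH : Measure ((UnitaryGroup.cmDatum L 2 (Matrix.of fun i j : Fin 2 => if i.val + j.val + 1 = 2 then (1 : L) else 0)).Local v × (UnitaryGroup.cmDatum L 1 (Matrix.of fun i j : Fin 1 => if i.val + j.val + 1 = 1 then (1 : L) else 0)).Local v)) [νH.IsHaarMeasure] [νH.IsMulRightInvariant]
        (νG₃ : Measure ((UnitaryGroup.cmDatum L 3 (Matrix.of fun i j : Fin 3 => if i.val + j.val + 1 = 3 then (1 : L) else 0)).Local v)) [νG₃.IsHaarMeasure] [νG₃.IsMulRightInvariant]
        (mH : OrbitalMeasureFamily ((UnitaryGroup.cmDatum L 2 (Matrix.of fun i j : Fin 2 => if i.val + j.val + 1 = 2 then (1 : L) else 0)).Local v × (UnitaryGroup.cmDatum L 1 (Matrix.of fun i j : Fin 1 => if i.val + j.val + 1 = 1 then (1 : L) else 0)).Local v)) (mG₃ : OrbitalMeasureFamily ((UnitaryGroup.cmDatum L 3 (Matrix.of fun i j : Fin 3 => if i.val + j.val + 1 = 3 then (1 : L) else 0)).Local v))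
        (_hmH : mH.IsCanonical (IsLocalGRegular L v) νH) (_hmG : mG₃.IsCanonical (fun γ => IsRegularElt (γ.val : GL (Fin 3) (UnitaryGroup.LocalRing L v))) νG₃),
        ∃ (cA cB : ℂ) (N₁ : ℕ),
          (∀ (a b : (w.1.adicCompletion L)) (n₁ n₂ n₃ k : ℕ) (i : Fin 3) (B : ℤ),
        a * (galAdicCompletionMap (L := L) (IsCMField.complexConj L) hw) a = 1 → b * (galAdicCompletionMap (L := L) (IsCMField.complexConj L) hw) b = 1 →
        Valued.v (a - 1) < Valued.v (2 : (w.1.adicCompletion L)) → Valued.v (b - 1) < Valued.v (2 : (w.1.adicCompletion L)) →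
        IsElementDatum (galAdicCompletionMap (L := L) (IsCMField.complexConj L) hw) ϖ (n0DerivedOfRecord d) (a * a) (b * b) n₁ n₂ n₃ →
        2 * ((n₁ + n₂) / 2) = n₁ + n₂ → 2 * k + d = n₁ + n₂ + n₃ + 2 → 2 * B = ((![n₁, n₂, n₃] : Fin 3 → ℕ) i : ℤ) - d + 2 - 2 * shiftR d tE → i = 2 →
        N₁ ≤ n₃ → (n₃ + d) % 2 = 0 →
        ((νG₃ (cmLocalIntegralLevel L 3 (Matrix.of fun i j : Fin 3 => if i.val + j.val + 1 = 3 then (1 : L) else 0) v : Set ((UnitaryGroup.cmDatum L 3 (Matrix.of fun i j : Fin 3 => if i.val + j.val + 1 = 3 then (1 : L) else 0)).Local v))).toReal : ℂ) * ((Fintype.card (Valued.ResidueField (w.1.adicCompletion L)) : ℂ) ^ ((n₁ + n₂) / 2))⁻¹ * (((omegaR (w.1.adicCompletion L) (galAdicCompletionMap (L := L) (IsCMField.complexConj L) hw) ϖ d a b i : ℤ) : ℂ) * ((amplTransvPlusDerived (Fintype.card (Valued.ResidueField (w.1.adicCompletion L))) d tE k B : ℚ) : ℂ)) =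
          cA * (((2 * ((Fintype.card (Valued.ResidueField (w.1.adicCompletion L)) : ℚ) ^ (((n₃ - d) / 2 : ℕ) + 1) - 1) / ((Fintype.card (Valued.ResidueField (w.1.adicCompletion L)) : ℚ) - 1) : ℚ)) : ℂ) + cB) ∧
          (∃ V ∈ 𝓝 (1 : ((UnitaryGroup.cmDatum L 2 (Matrix.of fun i j : Fin 2 => if i.val + j.val + 1 = 2 then (1 : L) else 0)).Local v × (UnitaryGroup.cmDatum L 1 (Matrix.of fun i j : Fin 1 => if i.val + j.val + 1 = 1 then (1 : L) else 0)).Local v)), ∀ γH ∈ V, IsLocalGRegular L v γH →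
        ¬ (∃ x : (w.1.adicCompletion L), (((((γH).1.val : GL (Fin 2) (UnitaryGroup.LocalRing L v)).val.map (Pi.evalRingHom (fun w' : UnitaryGroup.PlacesOver L v => w'.1.adicCompletion L) w))).charpoly).IsRoot x) →
        ∀ X : ℂ, (∀ s : Fin 2, stableOrbitalIntegralRel (IsLocalStablyConjH L v) mH (hFamily L w hw ϖ s) γH = (νH.real (Function.support (hFamily L w hw ϖ s)) : ℂ) * X + (if ((s : Fin 2) : ℕ) = d % 2 then (0 : ℂ) else -2 * (νH.real (Function.support (hFamily L w hw ϖ s)) : ℂ)) / 2) →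
          ∑ᶠ c : ConjClasses ((UnitaryGroup.cmDatum L 3 (Matrix.of fun i j : Fin 3 => if i.val + j.val + 1 = 3 then (1 : L) else 0)).Local v), ((finExplicitCollection L (Matrix.of fun i j : Fin 3 => if i.val + j.val + 1 = 3 then (1 : L) else 0) μ (finExplicitDelta_conj_left_all L (Matrix.of fun i j : Fin 3 => if i.val + j.val + 1 = 3 then (1 : L) else 0) μ) (finExplicitDelta_conj_right_all L (Matrix.of fun i j : Fin 3 => if i.val + j.val + 1 = 3 then (1 : L) else 0) μ)) v).Δ γH (Quotient.out c) * classOrbitalIntegral mG₃ ((gselStar 1) L v w hw ϖ) c =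
            ((fun s : Fin 2 => if ((s : Fin 2) : ℕ) = d % 2 then (cA + cB) / (2 * (νH.real (Function.support (hFamily L w hw ϖ s)) : ℂ)) else -cB / (2 * (νH.real (Function.support (hFamily L w hw ϖ s)) : ℂ))) 0 * (νH.real (Function.support (hFamily L w hw ϖ 0)) : ℂ) + (fun s : Fin 2 => if ((s : Fin 2) : ℕ) = d % 2 then (cA + cB) / (2 * (νH.real (Function.support (hFamily L w hw ϖ s)) : ℂ)) else -cB / (2 * (νH.real (Function.support (hFamily L w hw ϖ s)) : ℂ))) 1 * (νH.real (Function.support (hFamily L w hw ϖ 1)) : ℂ)) * X + ((fun s : Fin 2 => if ((s : Fin 2) : ℕ) = d % 2 then (cA + cB) / (2 * (νH.real (Function.support (hFamily L w hw ϖ s)) : ℂ)) else -cB / (2 * (νH.real (Function.support (hFamily L w hw ϖ s)) : ℂ))) 0 * (if ((0 : Fin 2) : ℕ) = d % 2 then (0 : ℂ) else -2 * (νH.real (Function.support (hFamily L w hw ϖ 0)) : ℂ)) + (fun s : Fin 2 => if ((s : Fin 2) : ℕ) = d % 2 then (cA + cB) / (2 * (νH.real (Function.support (hFamily L w hw ϖ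 s)) : ℂ)) else -cB / (2 * (νH.real (Function.support (hFamily L w hw ϖ s)) : ℂ))) 1 * (if ((1 : Fin 2) : ℕ) = d % 2 then (0 : ℂ) else -2 * (νH.real (Function.support (hFamily L w hw ϖ 1)) : ℂ))) / 2) ∧
          ((fun s : Fin 2 => if ((s : Fin 2) : ℕ) = d % 2 then (cA + cB) / (2 * (νH.real (Function.support (hFamily L w hw ϖ s)) : ℂ)) else -cB / (2 * (νH.real (Function.support (hFamily L w hw ϖ s)) : ℂ))) 0 * (νH.real (Function.support (hFamily L w hw ϖ 0)) : ℂ) + (fun s : Fin 2 => if ((s : Fin 2) : ℕ) = d % 2 then (cA + cB) / (2 * (νH.real (Function.support (hFamily L w hw ϖ s)) : ℂ)) else -cB / (2 * (νH.real (Function.support (hFamily L w hw ϖ s)) : ℂ))) 1 * (νH.real (Function.support (hFamily L w hw ϖ 1)) : ℂ) =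
          ((((1 - ((Ideal.absNorm v.asIdeal : ℝ))⁻¹) / 2) * (((Ideal.absNorm v.asIdeal : ℝ) ^ ((d % 2 + 3 * d - 1) / 2 - d / 2))⁻¹)) : ℂ) *
          (((νG₃.real (cmLocalIntegralLevel L 3 (Matrix.of fun i j : Fin 3 => if i.val + j.val + 1 = 3 then (1 : L) else 0) v : Set ((cmDatum L 3 (Matrix.of fun i j : Fin 3 => if i.val + j.val + 1 = 3 then (1 : L) else 0)).Local v)) : ℂ) /
            (νH.real ((((cmLocalIntegralLevel L 2 (Matrix.of fun i j : Fin 2 => if i.val + j.val + 1 = 2 then (1 : L) else 0) v).prod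
              (cmLocalIntegralLevel L 1 (Matrix.of fun i j : Fin 1 => if i.val + j.val + 1 = 1 then (1 : L) else 0) v) : Subgroup _) : Set _)) : ℂ)) *
          (νH.real (Function.support (hFamily L w hw ϖ 0)) : ℂ))) :=
  F0P3cDyRamHSideStubsOfRecord.hSideRows_transvPlus_ofRecord' stub_law_cleanSgn₂

/-- TIER-0 ROW · `f_{T+}` — PAID BY COMPOSITION (ED. 6; statement UNCHANGED): ★ `F0P3cDyRamHSideTransvPlusGuarded.pieceRowsWild_gselStar_one_of_fencedLaw_of_rows` junction-of-rows at `(shiftR, omegaR, n0DerivedOfRecord, amplTransvPlusDerived)` ∘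
★ `F0P3cDyRamTransvPlusLawOfCleanLevels.transvPlusLawTargetDerived_of` over the five ED. 6 letters (four `sorry` stubs + (α′) paid by name).  NAME ⊕ NAME; the debt is the four open stubs above.  [U4_Rows ← U3_Laws, U2G_Census, U2H_HSide] -/
theorem stub_rows_transvPlus : PieceRowsWild gselStar 1 :=
  F0P3cDyRamHSideTransvPlusGuarded.pieceRowsWild_gselStar_one_of_fencedLaw_of_rows shiftR omegaR n0DerivedOfRecord amplTransvPlusDerived
    (F0P3cDyRamTransvPlusLawOfCleanLevels.transvPlusLawTargetDerived_of n0DerivedOfRecord stub_law_levCleanLo stub_law_levCleanHi stub_law_labelClean stub_law_cleanSgn)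
    stub_hside_transvPlus

/-- TIER-0 STUB · the three population rows of the class-`−` near-transvection piece `f_{T−}`.  [U4_Rows ← U3_Laws, U2G_Census, U2H_HSide] -/
theorem stub_rows_transvMinus : PieceRowsWild gselStar 2 :=
  F0P3cDyRamTierZeroRowsTwoThreeOfLevels.pieceRowsWild_gselStar_two_of_fencedLaws_of_hsides shiftR omegaR depthOfRecord amplCs amplLevHi
    stub_rows_transvPlus stub_law_levLo stub_hside_levLo stub_law_levHi stub_hside_levHi

/-- TIER-0 STUB · the three population rows of the regular-profile piece `f_reg`.  [U4_Rows ← U3_Laws, U2G_Census, U2H_HSide] -/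
theorem stub_rows_regular : PieceRowsWild gselStar 3 :=
  F0P3cDyRamTierZeroRowsTwoThreeOfLevels.pieceRowsWild_gselStar_three_of_fencedLaw_of_hside shiftR omegaR depthOfRecord amplCs
    stub_rows_unit0 stub_law_sq stub_hside_sq

/-- TIER-0 STUB · PAID (★ `Theorems/F0P3cDyRamPiecePropsGselStar`, LH4-p12 (g0); unit U4 §1 rows ★ p854783 + ★ p854832) · the four pieces are smooth, supported in `K`, `Ad K`-invariant and left-invariant under `K(ϖ_w^{mstarFn})` at every wild place (elementary congruence
algebra on the explicit indicators: the shell and `valueSetMod` depend on `X mod ϖ^{m*}`, and a unitary integral `k` permutes `𝒪_w³` by `Φ₃`-isometries).  [U4_Rows] -/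
theorem stub_pieceProps : PiecePropsWild mstarFn gselStar :=
  Summit.HodgeConjecture.HodgeConjecture.Cruxes.H413.F0P3cDyRamPiecePropsGselStar.piecePropsWild_gselStar  -- PAID ((R-15) ★ twin of U4 `piecePropsWild_gselStar`)

/-- TIER-0 STUB · THE RANK LAYER: for every admissible unipotent datum `(S, mU)` the own-column labelling `e : ↥S → Fin 4` (`1 ↦ 1_K`, `T₊ ↦ f_{T+}`, `T₋ ↦ f_{T−}`,
`reg ↦ f_reg`) has invertible orbital-integral table: every `S × S` minor of the lower-triangular table `[[m,0,0,0],[a,s₊,0,0],[a′,0,s₋,0],[b,*,*,ρ]]` is triangular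
with non-zero diagonal (REF5 R5-3 (B): vanishing by support∕window∕label, positivity because each piece is `1` on a non-empty open part of its own orbit ∩ `K`;
`dOfPlace = d` via `stub_U0_dOfPlace_eq`; memo (0b-i) v1.2 levels `m* = 3 ∕ 6`).  [U4_Rows ← U0_WildTree] -/
theorem stub_rankTableWild : RankTableWild gselStar :=
  Summit.HodgeConjecture.HodgeConjecture.Cruxes.H413.F0P3cDyRamRankTableWildGselStar.rankTableWild_gselStar  -- PAID ★ p855060 ((R-15) ★ twin of U4 `rankTableWild_gselStar`; U4 rows T1 ★ p854790, T2 ★ p854888, T3 ★ p854943)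

/-! ### ED. 7 — THE FIRST PAY EDITION ((R-32); heir LEAD T20-05 (R-33)(4)): `stub_law_sq` PAID BY NAME — theorem line `:= F0P3cDyRamSqKappaSignLawOfBoxSum.dyadicFence_sqKappaSignLawAtS2_ofRecord` (statement bytes UNCHANGED; the (L-sq) chain LH4-p12 (g7) PARTS 1–5 ∘ LH4-p10 (g6) (T-box | sq) ★ p860013∕p860095 ∘ F0P3a-p01∕LH4-p09 cell organs; no hypothesis). Open tier-0 stubs after this edition: NINE (`stub_law_levLo ∕ hside_levLo ∕ law_levHi ∕ hside_levHi ∕ hside_sq ∕ law_levCleanLo ∕ law_levCleanHi ∕ law_cleanSgn ∕ hside_transvPlus`). -/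

/-! ### ED. 8 — ED. 8 (pre-cut, pending ★+BUILT of the primed heads): the four lev laws PAID BY NAME — stub_law_lev{Lo,Hi,CleanLo,CleanHi} := F0P3cDyRamLevKappaSignLawsOfRecord.dyadicFence_levKappaSignLawAtS2_{lo,hi,cleanLo,cleanHi}_ofRecord' (bare constants, rule 69 / (R-32)); sorries 9 → 5. -/

/-! ### ED. 9 — THE H-SIDES PAID BY NAME, T₊ RE-LINED 1 → 1 ONTO β₂ ((R-32) batch pay edition №3; (R-33) + addendum, heir LEAD TIER 14:20Z ∕ T20-12; desk ISSUE 21 shape (A′); dealer PEN #13∕#14).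
`stub_hside_levLo ∕ levHi ∕ sq := F0P3cDyRamHSideStubsOfLevelsCensusLaw.hSideLevelsTripleS_{lo,hi}_ofRecord ∕ hSideSqTripleS_ofRecord F0P3cDyRamHSideStubsOfRecord.hEnd_ofRecord` (★ D2 p860744 heads applied BY NAME at ★ p861872 `hEnd_ofRecord := levels_typeTwo_censusLaw' …` = THE (LAW) END hypothesis-free, ★ D1 p860737 over
U ★ p860533 `levelsCensusA` + RamK ★ p860440 `levelsCensusB` + RamM `levelsCensusC` (LH4-p07∕p08∕p06 (g9∕g9∕g7) lane)); `stub_hside_transvPlus := F0P3cDyRamHSideStubsOfRecord.hSideRows_transvPlus_ofRecord' stub_law_cleanSgn₂`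
(★ D3 p860783 at `hC := levelsCensusC`; the row's only letter is now the NEW typed stub `stub_law_cleanSgn₂` = β₂, LH4-p04 lineage payer).  Statement bytes of all 18 old decls UNCHANGED; open stubs after this
edition: `stub_law_cleanSgn` (β, the TABLE — LH4-p05 (g8)) and `stub_law_cleanSgn₂` (β₂, (S4) — LH4-p04 (g8)). -/

/-! ### ED. 10 — (β) PAID BY NAME ((R-32) batch pay edition №4, 1-of-2; heir LEAD F0P3a-plan (g22) T21-00∕T21-01 «=»; β chair LH4-p05 (g9) LEDGER #24;
dealer∕pen LH4-plan (g14)).  ONE delta: `stub_law_cleanSgn` body `by sorry` → `F0P3cDyRamCleanSgnOfRecord.cleanSgn_ofRecord` (★ p862529; 0 binders; over ★ p862243 tube rows ·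
★ p862244 `hRest_of_heads` ⟸ the four schemas ★ p862300 hK · ★ p862389 hW · ★ p862354 hB · ★ p862486 hZ; statement TEXT∕TYPE UNCHANGED — MetaM Expr == d2313163371,
LH-ref2 (g13) T2 RIDER (d)), +1 `Theorems` import; every other byte of ED. 9 (15ff489c14e525b6) unchanged — `DyRamCore_of` ∕ §2 untouched, 0 statement deltas (declcmp 19∕19,
1 BODY-ONLY).  OPEN after this edition: exactly ONE registered stub, (β₂) `stub_law_cleanSgn₂` (pay head of record `cleanSgnDiffTypeTwo_ofRecord`; β₂ sub-dealer LH4-p04 (g9)). -/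

/-! ## §2  the sorry-free composition to the organ BY NAME -/

set_option maxHeartbeats 800000 in
-- statement-heavy: the organ text is letter-sized
/-- **`DyRamCore_of` — THE TIER-0 COMPOSITION (sorry-free; axioms = the trio): the six stub statements ⟹ `stub_DyRamCore`'s statement VERBATIM** (leaf
`F0_P3c_DyadicPaydown.lean` ED. 4 :147–:170, type digit 4239658620), through ★ `anchorRowsWild_of_slices` (#15) → ★ `rankTransferWild_of_anchorRows` (#6) → ★
`dyRamCore_of_rankTransferWild` (#14) at the level schedule `mstarFn` and the explicit selector `gselStar`. -/
theorem DyRamCore_of (h0 : PieceRowsWild gselStar 0) (h1 : PieceRowsWild gselStar 1) (h2 : PieceRowsWild gselStar 2) (h3 : PieceRowsWild gselStar 3)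
    (hP : PiecePropsWild mstarFn gselStar) (hR : RankTableWild gselStar) :
    ∀ (L : Type) [Field L] [NumberField L] [IsCMField L] (μ : HeckeCharacter L)
      {v : HeightOneSpectrum (𝓞 ↥(maximalRealSubfield L))} (w : UnitaryGroup.PlacesOver L v)
      (_hw : IsCMField.complexConj L • w.1 = w.1) (_he : v.asIdeal.ramificationIdx' w.1.asIdeal ≠ 1)
      (_hμu : μ.IsUnitary)
      (_hμω : ∀ x : ideleGroup ↥(maximalRealSubfield L), μ (AdeleRing.ideleBaseChange ↥(maximalRealSubfield L) L x) = quadraticHeckeCharCM L x)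
      (_h2 : ¬ IsUnit (2 : 𝒪[w.1.adicCompletion L]))
      [MeasurableSpace ((UnitaryGroup.cmDatum L 3 (Matrix.of fun i j : Fin 3 => if i.val + j.val + 1 = 3 then (1 : L) else 0)).Local v)] [BorelSpace ((UnitaryGroup.cmDatum L 3 (Matrix.of fun i j : Fin 3 => if i.val + j.val + 1 = 3 then (1 : L) else 0)).Local v)]
      [∀ γ : ((UnitaryGroup.cmDatum L 3 (Matrix.of fun i j : Fin 3 => if i.val + j.val + 1 = 3 then (1 : L) else 0)).Local v), MeasurableSpace (((UnitaryGroup.cmDatum L 3 (Matrix.of fun i j : Fin 3 => if i.val + j.val + 1 = 3 then (1 : L) else 0)).Local v) ⧸ Subgroup.centralizer ({γ} : Set ((UnitaryGroup.cmDatum L 3 (Matrix.of fun i j : Fin 3 => if i.val + j.val + 1 = 3 then (1 : L) else 0)).Local v)))]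
      [∀ γ : ((UnitaryGroup.cmDatum L 3 (Matrix.of fun i j : Fin 3 => if i.val + j.val + 1 = 3 then (1 : L) else 0)).Local v), BorelSpace (((UnitaryGroup.cmDatum L 3 (Matrix.of fun i j : Fin 3 => if i.val + j.val + 1 = 3 then (1 : L) else 0)).Local v) ⧸ Subgroup.centralizer ({γ} : Set ((UnitaryGroup.cmDatum L 3 (Matrix.of fun i j : Fin 3 => if i.val + j.val + 1 = 3 then (1 : L) else 0)).Local v)))]
      [MeasurableSpace ((UnitaryGroup.cmDatum L 2 (Matrix.of fun i j : Fin 2 => if i.val + j.val + 1 = 2 then (1 : L) else 0)).Local v × (UnitaryGroup.cmDatum L 1 (Matrix.of fun i j : Fin 1 => if i.val + j.val + 1 = 1 then (1 : L) else 0)).Local v)] [BorelSpace ((UnitaryGroup.cmDatum L 2 (Matrix.of fun i j : Fin 2 => if i.val + j.val + 1 = 2 then (1 : L) else 0)).Local v × (UnitaryGroup.cmDatum L 1 (Matrix.of fun i j : Fin 1 => if i.val + j.val + 1 = 1 then (1 : L) else 0)).Local v)]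
      [∀ a : ((UnitaryGroup.cmDatum L 2 (Matrix.of fun i j : Fin 2 => if i.val + j.val + 1 = 2 then (1 : L) else 0)).Local v × (UnitaryGroup.cmDatum L 1 (Matrix.of fun i j : Fin 1 => if i.val + j.val + 1 = 1 then (1 : L) else 0)).Local v), MeasurableSpace (((UnitaryGroup.cmDatum L 2 (Matrix.of fun i j : Fin 2 => if i.val + j.val + 1 = 2 then (1 : L) else 0)).Local v × (UnitaryGroup.cmDatum L 1 (Matrix.of fun i j : Fin 1 => if i.val + j.val + 1 = 1 then (1 : L) else 0)).Local v) ⧸ Subgroup.centralizer ({a} : Set ((UnitaryGroup.cmDatum L 2 (Matrix.of fun i j : Fin 2 => if i.val + j.val + 1 = 2 then (1 : L) else 0)).Local v × (UnitaryGroup.cmDatum L 1 (Matrix.of fun i j : Fin 1 => if i.val + j.val + 1 = 1 then (1 : L) else 0)).Local v)))]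
      [∀ a : ((UnitaryGroup.cmDatum L 2 (Matrix.of fun i j : Fin 2 => if i.val + j.val + 1 = 2 then (1 : L) else 0)).Local v × (UnitaryGroup.cmDatum L 1 (Matrix.of fun i j : Fin 1 => if i.val + j.val + 1 = 1 then (1 : L) else 0)).Local v), BorelSpace (((UnitaryGroup.cmDatum L 2 (Matrix.of fun i j : Fin 2 => if i.val + j.val + 1 = 2 then (1 : L) else 0)).Local v × (UnitaryGroup.cmDatum L 1 (Matrix.of fun i j : Fin 1 => if i.val + j.val + 1 = 1 then (1 : L) else 0)).Local v) ⧸ Subgroup.centralizer ({a} : Set ((UnitaryGroup.cmDatum L 2 (Matrix.of fun i j : Fin 2 => if i.val + j.val + 1 = 2 then (1 : L) else 0)).Local v × (UnitaryGroup.cmDatum L 1 (Matrix.of fun i j : Fin 1 => if i.val + j.val + 1 = 1 then (1 : L) else 0)).Local v)))]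
      (νH : Measure ((UnitaryGroup.cmDatum L 2 (Matrix.of fun i j : Fin 2 => if i.val + j.val + 1 = 2 then (1 : L) else 0)).Local v × (UnitaryGroup.cmDatum L 1 (Matrix.of fun i j : Fin 1 => if i.val + j.val + 1 = 1 then (1 : L) else 0)).Local v)) [νH.IsHaarMeasure] [νH.IsMulRightInvariant]
      (νG₃ : Measure ((UnitaryGroup.cmDatum L 3 (Matrix.of fun i j : Fin 3 => if i.val + j.val + 1 = 3 then (1 : L) else 0)).Local v)) [νG₃.IsHaarMeasure] [νG₃.IsMulRightInvariant]
      {mH : OrbitalMeasureFamily ((UnitaryGroup.cmDatum L 2 (Matrix.of fun i j : Fin 2 => if i.val + j.val + 1 = 2 then (1 : L) else 0)).Local v × (UnitaryGroup.cmDatum L 1 (Matrix.of fun i j : Fin 1 => if i.val + j.val + 1 = 1 then (1 : L) else 0)).Local v)} {mG₃ : OrbitalMeasureFamily ((UnitaryGroup.cmDatum L 3 (Matrix.of fun i j : Fin 3 => if i.val + j.val + 1 = 3 then (1 : L) else 0)).Local v)},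
      mH.IsCanonical (IsLocalGRegular L v) νH → mG₃.IsCanonical (fun γ => IsRegularElt (γ.val : GL (Fin 3) (UnitaryGroup.LocalRing L v))) νG₃ →
      ShalikaGermExpansionNonsplit L (Matrix.of fun i j : Fin 3 => if i.val + j.val + 1 = 3 then (1 : L) else 0) v →
      ∀ (φ₃ : ((UnitaryGroup.cmDatum L 3 (Matrix.of fun i j : Fin 3 => if i.val + j.val + 1 = 3 then (1 : L) else 0)).Local v) → ℂ), IsLocSmooth φ₃ →
        ∃ V ∈ 𝓝 (1 : ((UnitaryGroup.cmDatum L 2 (Matrix.of fun i j : Fin 2 => if i.val + j.val + 1 = 2 then (1 : L) else 0)).Local v × (UnitaryGroup.cmDatum L 1 (Matrix.of fun i j : Fin 1 => if i.val + j.val + 1 = 1 then (1 : L) else 0)).Local v)), ∃ φH : ((UnitaryGroup.cmDatum L 2 (Matrix.of fun i j : Fin 2 => if i.val + j.val + 1 = 2 then (1 : L) else 0)).Local v × (UnitaryGroup.cmDatum L 1 (Matrix.of fun i j : Fin 1 => if i.val + j.val + 1 = 1 then (1 : L) else 0)).Local v) → ℂ, IsLocSmooth φH ∧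
          ∀ γH ∈ V, IsLocalGRegular L v γH →
            stableOrbitalIntegralRel (IsLocalStablyConjH L v) mH φH γH =
              ∑ᶠ c : ConjClasses ((UnitaryGroup.cmDatum L 3 (Matrix.of fun i j : Fin 3 => if i.val + j.val + 1 = 3 then (1 : L) else 0)).Local v), ((finExplicitCollection L (Matrix.of fun i j : Fin 3 => if i.val + j.val + 1 = 3 then (1 : L) else 0) μ (finExplicitDelta_conj_left_all L (Matrix.of fun i j : Fin 3 => if i.val + j.val + 1 = 3 then (1 : L) else 0) μ) (finExplicitDelta_conj_right_all L (Matrix.of fun i j : Fin 3 => if i.val + j.val + 1 = 3 then (1 : L) else 0) μ)) v).Δ γH (Quotient.out c) * classOrbitalIntegral mG₃ φ₃ c :=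
  dyRamCore_of_rankTransferWild mstarFn
    (rankTransferWild_of_anchorRows mstarFn
      (anchorRowsWild_of_slices mstarFn gselStar hP hR (fun j => by
        fin_cases j
        · exact h0
        · exact h1
        · exact h2
        · exact h3)))

end Summit.HodgeConjecture.HodgeConjecture.Cruxes.H413.F0P3cDyRamFourFrame

end
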